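import Summits.ABC.IUTFork.Cor312LicenceShallowMultiSlotLicence
import Summits.ABC.IUTFork.Cor312PinnedThetaRealSharpNegativeF7
import HarnessLib

/-!
# [IUTchIII] Cor. 3.12 — a CONCRETE INHABITANT of the (xi-f) licence / branch C's hull-level antecedent beyond the
# one-factor window: `F = ℚ(√7)`, the bad place `(√7)` (`e = 2`, `p = 7`), `l = 5`, realising ideles `ord(t_q) = 1`,
# `ord(t_{Θ,j}) = j²` — the multi-slot window at the boundary `1 = 2·⌈4/2⌉ − 3·1`

PROOF-ONLY record file (D-0012; 0 definitions, 0 `Prop` facts) of the abc-iut cell (WAVE-5 prover seat abc-iut-w5-d180,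
gen 5; row «LICENCE-MULTISLOT-LOWER», instance). TAKES NO SIDE on [IUTchIII] Cor. 3.12 (S. Mochizuki, *Inter-universal
Teichmüller theory III*, kurims manuscript `paper:url-4b091feeb646`, Cor. 3.12 p. 173–174; Step (xi) (xi-f) p. 184 l. 26–27;
Thm. 3.11 (i) (Ind2) p. 154) or on any author. It instantiates this seat's `licence_settingDHVolSharp_of_tame_slots` /
`qRegion_subset_thetaHull_settingDHVolSharp_of_tame_orders` (p439967/p440550/p441217) at abc-iut-c312-14's number field
`RamifiedMover.F7 = ℚ(√7)` with its place `v7 = (√7)` (`Cor312TameQuadInstance`: `e(v7|7) = 2`, `f = 1`; abc-iut-w4-d087's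
`eq_v7_of_residueChar_eq_seven`: the ONLY place over `7`), the shape proposed by abc-iut-w6-d114 (HOME/STATUS 09:38:19Z):

* `licence_settingDHVolSharp_F7` / `licence_settingPrVolSharp_F7` / `exists_qPinned_and_hull_settingPrVolSharp_F7` — for EVERY
  pilot datum `X` over `ℚ(√7)` with `S ⊆ {v7}` and `l⋇ = 2` (`l = 5`), every logarithm family analytic at the primes, every
  context datum of the sharp real settings, and all pilot ideles that are units off `S` and REALISE the shape `‖t_{q,v7}‖ = ‖ϖ‖`,
  `‖t_{Θ,j,v7}‖ = ‖ϖ‖^{j²}` (`j = 1, 2`; Dupuy–Hilado (3.4) with `ord_{v7}(q) = 2l = 10`): the (xi-f) licence HOLDS and branch C's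
  «∃ ρ qK, QPinned ∧ PilotKummerCompatHull» is INHABITED. At `j = 2` this is OUTSIDE the one-factor window of abc-iut-w5-d236's
  `Cor312LicenceShallowRealTame` (`ord(t_Θ) = 4 > e = 2`): the two non-last capsule slots donate one order each.
* `exists_pilotData_F7`, `exists_realising_ideles_F7`, **`exists_licence_settingPrVolSharp_F7`** — the binders ARE satisfiable:
  a pilot datum (`j_E := 1/√7`, `S = {v7}`, `l = 5`) and realising ideles exist, so «∃ X t_q t_Θ, ∀ context data, Licence» is a
  closed kernel statement (NON-VACUITY of the inhabited side of the per-datum tame dichotomy, C-R18/C-R22 case B-shallow).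

HONEST SCOPE. A statement about OUR typed sharp containers (Θ-regions constant in `m`) and Dupuy–Hilado's typed (Ind1)/(Ind2)
(`logShellsDH`; (Ind2) independent per capsule slot and place, as abc-iut-c312-1 typed Thm. 3.11 (i)); the licence / hull reading
is a STRONGER-THAN-PRINT form (ADJUDICATION-SPEC §2 (G1′)); `X` is a `PilotData` over `ℚ(√7)`, NOT the pilot data of an initial
Θ-datum of [IUTchI] Def. 3.1 (those live over `K = F(E[l])`, abc-iut-C-cert-3 / w5-d009 lanes); nothing here bears on the printed
GLOBAL inequality or asserts anything about the author's intended hull; nothing asserts or refutes [IUTchIII] Cor. 3.12.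
[cite: Mochizuki2012, IUTchIII Cor. 3.12 p.173–175, Thm. 3.11 (i) p.154, Step (xi) p.184] [cite: DupuyHilado2025, §3.4, §3.9, §4.9]
[claim: Mochizuki2012, status: disputed] for every IUT sentence quoted. Everything about `ℚ(√7)` is [folklore]. typed ≠ proved;
instantiated ≠ endorsed.
-/

noncomputable section

open Set Function
open scoped Pointwise

namespace Summit.ABC.IUTFork.Thm311.Real

open Cor312 Cor312.Setting Cor312Vol Literature.IUT.LogThetaLattice Literature.IUT.LogVolume NumberField IsDedekindDomain
open Literature.NumberTheory.NumberFields Literature.NumberTheory.GaloisRepresentations.Ultrametric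
open Summit.ABC.IUTFork.RamifiedMover

section Setting

variable (X : PilotData ↥F7) {logv : PadicLogs ↥F7} (hlog : LogvAnalytic logv)
  (M : Type) [Field M] [NumberField M]
  (archPk : ∀ (j : (thetaIndex X).Label) (vQ : (thetaIndex X).VQ), Set ((logShellsDH X logv).Packet j vQ))
  (archSub : ∀ (j : (thetaIndex X).Label) (v : (thetaIndex X).V),
    Set ((logShellsDH X logv).Packet j ((thetaIndex X).over v)))
  (Ψ : ℤ → ∀ v : (thetaIndex X).V, v ∈ (thetaIndex X).Vbad → Set ((logShellsDH X logv).StarPacket v))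
  (act : ℤ → ∀ v : (thetaIndex X).V, v ∈ (thetaIndex X).Vbad →
    (logShellsDH X logv).StarPacket v → Module.End ℚ ((logShellsDH X logv).StarPacket v))
  (Mmod : ℤ → ∀ j : (thetaIndex X).LabelStar, Set ((logShellsDH X logv).GlobalPacket j.1))
  (region : ℤ → ∀ j : (thetaIndex X).LabelStar, FinDivisor M → ∀ vQ : (thetaIndex X).VQ,
    Set ((logShellsDH X logv).Packet j.1 vQ))
  (n : ℤ) {HT : Type} {LogLink : HT → HT → Type} {IsFull : ∀ {s t : HT}, LogLink s t → Prop}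
  (lat : LGPGaussianLogThetaLattice LogLink IsFull)
  {Frd : Type} {IsoF : Frd → Frd → Type} {Ob : Frd → Type} {realify : Frd → Frd} {Strip : Type}
  {IsoS : Strip → Strip → Type} {Mv : ∀ v : (thetaIndex X).V, v ∈ (thetaIndex X).Vbad → Type}
  [∀ v h, Monoid (Mv v h)]
  (sig : GlobalLGPFrobenioidSignature (thetaIndex X).lstar (thetaIndex X).V (· ∈ (thetaIndex X).Vbad)
    Frd IsoF Ob realify Strip IsoS Mv)
  (split : SplittingMonoids Mv) {ObΔ : Type} {N : ∀ v : (thetaIndex X).V, v ∈ (thetaIndex X).Vbad → Type}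
  [∀ v h, Monoid (N v h)] (qData : QPilotData ObΔ N)
  (tq : ∀ (pp : Nat.Primes) (x : (thetaIndex X).Fibre (.inr pp)), haveI : Fact (pp : ℕ).Prime := ⟨pp.2⟩; kOf X pp.1 x)
  (t : ∀ (pp : Nat.Primes) (_ : Fin X.lstar) (x : (thetaIndex X).Fibre (.inr pp)),
    haveI : Fact (pp : ℕ).Prime := ⟨pp.2⟩; kOf X pp.1 x)
  (htq0 : ∀ pp x, tq pp x ≠ 0)
  (htq1 : ∀ (pp : Nat.Primes) (x : (thetaIndex X).Fibre (.inr pp)),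
    haveI : Fact (pp : ℕ).Prime := ⟨pp.2⟩; placeOf X pp.1 x ∉ X.S → ‖tq pp x‖ = 1)
  (col : ℤ → Column (logShellsDH X logv))

/-! ## 1. The fibre over `7` of a pilot index over `ℚ(√7)` is the single place `v7` -/

/-- Every fibre point over `7` of a pilot index over `ℚ(√7)` IS the place `v7 = (√7)` (abc-iut-w4-d087
`eq_v7_of_residueChar_eq_seven`). [folklore] -/
theorem placeOf_p7_eq_v7 (x : (thetaIndex X).Fibre (.inr p7)) :
    haveI : Fact (p7 : ℕ).Prime := ⟨p7.2⟩; placeOf X p7.1 x = v7 := by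
  obtain ⟨x1, hx⟩ := x
  rcases x1 with w | v
  · exact absurd hx (by simp [thetaIndex])
  · exact eq_v7_of_residueChar_eq_seven v (congrArg Subtype.val (Sum.inr.inj hx))

/-- Over a prime `p ≠ 7` no fibre point is a bad place when `S ⊆ {v7}`. [folklore] -/
theorem placeOf_not_mem_of_ne_p7 (hS : ∀ v ∈ X.S, v = v7) {pp : Nat.Primes} (hpp : pp ≠ p7)
    (w : (thetaIndex X).Fibre (.inr pp)) : haveI : Fact (pp : ℕ).Prime := ⟨pp.2⟩; placeOf X pp.1 w ∉ X.S := by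
  haveI : Fact (pp : ℕ).Prime := ⟨pp.2⟩
  intro hw
  obtain ⟨x1, hx⟩ := w
  rcases x1 with u | v
  · exact absurd hx (by simp [thetaIndex])
  · have hres : Literature.IUT.LogVolume.residueChar (↥F7) v = (pp : ℕ) := congrArg Subtype.val (Sum.inr.inj hx)
    have hv7 : v = v7 := hS _ hw
    rw [hv7, logVolume_residueChar_v7] at hres
    exact hpp (Subtype.ext hres.symm)

/-! ## 2. The packet at `(j, 7)`: the orders window `2·⌊(j²−1)/2⌋ + 1 − j ≤ 1` holds for `j = 1, 2` -/

/-- **At `(i+1, 7)` over `ℚ(√7)` with `l⋇ = 2` and realising ideles at `v7` (`‖t_q‖ = ‖ϖ‖`, `‖t_{Θ,i+1}‖ = ‖ϖ‖^{(i+1)²}`) the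
q-pilot region lies in `ⁿ˒°𝒰_{i+1,7}`** — `qRegion_subset_thetaHull_settingDHVolSharp_of_tame_orders` at `e = 2`, `p = 7`:
`i = 0`: `0 + 1 − 1 ≤ 1`; `i = 1`: `2·1 + 1 − 2 = 1 ≤ 1` (the boundary of the multi-slot window).
[cite: DupuyHilado2025, §3.4, §3.9, §4.9] [claim: Mochizuki2012, status: disputed] -/
theorem qRegion_subset_thetaHull_settingDHVolSharp_F7_seven (hl : X.lstar = 2) (i : Fin (thetaIndex X).lstar)
    (h7 : ∀ w : (thetaIndex X).Fibre (.inr p7), haveI : Fact (p7 : ℕ).Prime := ⟨p7.2⟩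
      ∃ ϖ : (kOf X p7.1 w)ˣ, IsUniformizer ϖ ∧ ‖tq p7 w‖ = ‖(ϖ : kOf X p7.1 w)‖ ∧
        ∀ i : Fin X.lstar, ‖t p7 i w‖ = ‖(ϖ : kOf X p7.1 w)‖ ^ (((i : ℕ) + 1) ^ 2)) :
    (settingDHVolSharp X hlog M archPk archSub Ψ act Mmod region n lat sig split qData tq t htq0 htq1).qRegion
        (labelSucc i) (.inr p7) ⊆
      (settingDHVolSharp X hlog M archPk archSub Ψ act Mmod region n lat sig split qData tq t htq0 htq1).thetaHull
        (labelSucc i) (.inr p7) := by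
  haveI : Fact (p7 : ℕ).Prime := ⟨p7.2⟩
  choose ϖ hϖ hq ht using h7
  refine qRegion_subset_thetaHull_settingDHVolSharp_of_tame_orders X hlog M archPk archSub Ψ act Mmod region n lat sig split qData
    tq t htq0 htq1 i p7 (by norm_num [p7]) 2 (by norm_num [p7]) ϖ (fun x => ⟨?_, hϖ x⟩) fun w => Or.inr ?_
  · rw [placeOf_p7_eq_v7 X x]
    exact ramificationIdx_v7
  · have hi : (i : ℕ) < 2 := by have h := i.2; simp only [thetaIndex] at h; omega
    refine ⟨(((i : ℕ) + 1) ^ 2 : ℕ), 1, ?_, ?_, by exact_mod_cast Nat.one_le_pow _ _ (Nat.succ_pos _), ?_⟩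
    · rw [ht w i, zpow_natCast]
    · rw [hq w, zpow_one]
    · push_cast
      interval_cases (i : ℕ) <;> norm_num

/-! ## 3. The licence and branch C's antecedent over `ℚ(√7)` -/

/-- **THE (xi-f) LICENCE HOLDS at `settingDHVolSharp` over `ℚ(√7)`** for every pilot datum with `S ⊆ {v7}`, `l⋇ = 2`, Θ-ideles units
off `S`, and realising ideles at `v7` (`‖t_{q,v7}‖ = ‖ϖ‖`, `‖t_{Θ,j,v7}‖ = ‖ϖ‖^{j²}`): the packet at `7` by §2, the other primes carry
no bad place (identity movers), the archimedean packets are free. [cite: DupuyHilado2025, §3.4, §3.9, §4.9]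
[claim: Mochizuki2012, status: disputed] -/
theorem licence_settingDHVolSharp_F7 (hl : X.lstar = 2) (hS : ∀ v ∈ X.S, v = v7)
    (ht1 : ∀ (pp : Nat.Primes) (i : Fin X.lstar) (x : (thetaIndex X).Fibre (.inr pp)),
      haveI : Fact (pp : ℕ).Prime := ⟨pp.2⟩; placeOf X pp.1 x ∉ X.S → ‖t pp i x‖ = 1)
    (h7 : ∀ w : (thetaIndex X).Fibre (.inr p7), haveI : Fact (p7 : ℕ).Prime := ⟨p7.2⟩
      ∃ ϖ : (kOf X p7.1 w)ˣ, IsUniformizer ϖ ∧ ‖tq p7 w‖ = ‖(ϖ : kOf X p7.1 w)‖ ∧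
        ∀ i : Fin X.lstar, ‖t p7 i w‖ = ‖(ϖ : kOf X p7.1 w)‖ ^ (((i : ℕ) + 1) ^ 2)) :
    Thm311ToCor312.Licence (settingDHVolSharp X hlog M archPk archSub Ψ act Mmod region n lat sig split qData tq t htq0 htq1) := by
  intro i vQ
  cases vQ with
  | inl u =>
    exact qRegion_subset_thetaHull_settingDHVolSharp_inl X hlog M archPk archSub Ψ act Mmod region n lat sig split qData tq t htq0
      htq1 (labelSucc i) u
  | inr pp =>
    by_cases hpp : pp = p7
    · subst hpp
      exact qRegion_subset_thetaHull_settingDHVolSharp_F7_seven X hlog M archPk archSub Ψ act Mmod region n lat sig split qData tq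
        t htq0 htq1 hl i h7
    · exact qRegion_subset_thetaHull_settingDHVolSharp_of_forall_not_mem X hlog M archPk archSub Ψ act Mmod region n lat sig split
        qData tq t htq0 htq1 i pp ht1 (placeOf_not_mem_of_ne_p7 X hS hpp)

/-- **The same at the print-normalised sharp setting `settingPrVolSharp`.** [claim: Mochizuki2012, status: disputed] -/
theorem licence_settingPrVolSharp_F7 (hl : X.lstar = 2) (hS : ∀ v ∈ X.S, v = v7)
    (ht1 : ∀ (pp : Nat.Primes) (i : Fin X.lstar) (x : (thetaIndex X).Fibre (.inr pp)),
      haveI : Fact (pp : ℕ).Prime := ⟨pp.2⟩; placeOf X pp.1 x ∉ X.S → ‖t pp i x‖ = 1)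
    (h7 : ∀ w : (thetaIndex X).Fibre (.inr p7), haveI : Fact (p7 : ℕ).Prime := ⟨p7.2⟩
      ∃ ϖ : (kOf X p7.1 w)ˣ, IsUniformizer ϖ ∧ ‖tq p7 w‖ = ‖(ϖ : kOf X p7.1 w)‖ ∧
        ∀ i : Fin X.lstar, ‖t p7 i w‖ = ‖(ϖ : kOf X p7.1 w)‖ ^ (((i : ℕ) + 1) ^ 2)) :
    Thm311ToCor312.Licence (settingPrVolSharp X hlog M archPk archSub Ψ act Mmod region n lat sig split qData tq t htq0 htq1) := by
  rw [licence_settingPrVolSharp_iff_settingDHVolSharp]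
  exact licence_settingDHVolSharp_F7 X hlog M archPk archSub Ψ act Mmod region n lat sig split qData tq t htq0 htq1 hl hS ht1 h7

/-- **BRANCH C's HULL-LEVEL ANTECEDENT «∃ ρ qK, QPinned ∧ PilotKummerCompatHull» IS INHABITED at `settingPrVolSharp` over `ℚ(√7)`**
(any columns `col`; integral q-ideles for the label `0`). With C-cert-1's `thetaSide_of_exists_qPinned_and_hull_settingPrVolSharp`
the typed Θ-side inequality follows there. [cite: DupuyHilado2025, §3.4, §3.9, §4.9] [claim: Mochizuki2012, status: disputed] -/
theorem exists_qPinned_and_hull_settingPrVolSharp_F7 (hl : X.lstar = 2) (hS : ∀ v ∈ X.S, v = v7)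
    (htqle : ∀ pp x, ‖tq pp x‖ ≤ 1)
    (ht1 : ∀ (pp : Nat.Primes) (i : Fin X.lstar) (x : (thetaIndex X).Fibre (.inr pp)),
      haveI : Fact (pp : ℕ).Prime := ⟨pp.2⟩; placeOf X pp.1 x ∉ X.S → ‖t pp i x‖ = 1)
    (h7 : ∀ w : (thetaIndex X).Fibre (.inr p7), haveI : Fact (p7 : ℕ).Prime := ⟨p7.2⟩
      ∃ ϖ : (kOf X p7.1 w)ˣ, IsUniformizer ϖ ∧ ‖tq p7 w‖ = ‖(ϖ : kOf X p7.1 w)‖ ∧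
        ∀ i : Fin X.lstar, ‖t p7 i w‖ = ‖(ϖ : kOf X p7.1 w)‖ ^ (((i : ℕ) + 1) ^ 2)) :
    ∃ (ρ' : (∀ v : (thetaIndex X).V, v ∈ (thetaIndex X).Vbad → Set ((logShellsDH X logv).StarPacket v)) →
          ∀ (j : (thetaIndex X).Label) (vQ : (thetaIndex X).VQ), Set ((logShellsDH X logv).Packet j vQ))
        (qK : ∀ v : (thetaIndex X).V, v ∈ (thetaIndex X).Vbad → Set ((logShellsDH X logv).StarPacket v)),
        QPinned ({ toSituation := situationPrVol X hlog M archPk archSub Ψ act Mmod region, col := col } :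
            LatticeSituation (thetaIndex X))
          (settingPrVolSharp X hlog M archPk archSub Ψ act Mmod region n lat sig split qData tq t htq0 htq1) ρ' qK ∧
        PilotKummerCompatHull ({ toSituation := situationPrVol X hlog M archPk archSub Ψ act Mmod region, col := col } :
            LatticeSituation (thetaIndex X))
          (settingPrVolSharp X hlog M archPk archSub Ψ act Mmod region n lat sig split qData tq t htq0 htq1) ρ' qK := by
  refine (Conditional.Antecedent.exists_qPinned_and_hull_iff
    ({ toSituation := situationPrVol X hlog M archPk archSub Ψ act Mmod region, col := col } : LatticeSituation (thetaIndex X))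
    (settingPrVolSharp X hlog M archPk archSub Ψ act Mmod region n lat sig split qData tq t htq0 htq1)).2 fun j vQ => ?_
  by_cases hj : 0 < (j : ℕ)
  · have hj' : j = labelSucc ⟨(j : ℕ) - 1, by have := j.2; simp only [thetaIndex] at this ⊢; omega⟩ := by
      ext; simp only [labelSucc, Fin.val_succ]; omega
    rw [hj']
    exact licence_settingDHVolSharp_F7 X hlog M archPk archSub Ψ act Mmod region n lat sig split qData tq t htq0 htq1 hl hS ht1 h7 _ vQ
  · refine qRegion_subset_thetaHull_settingDHVolSharp_of_movers X hlog M archPk archSub Ψ act Mmod region n lat sig split qData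
      tq t htq0 htq1 j vQ fun pp x => exists_mover_of_norm_le X hlog tq t pp j x ?_
    haveI : Fact (pp : ℕ).Prime := ⟨pp.2⟩
    unfold labelIdele
    rw [dif_neg hj, norm_one]
    exact htqle pp x

end Setting

/-! ## 4. NON-VACUITY: the pilot datum and the realising ideles EXIST -/

/-- **A pilot datum over `ℚ(√7)` with `S = {v7}` and `l = 5`** (`j_E := 1/√7` has `ord_{v7} = −1 < 0`). [folklore] -/
theorem exists_pilotData_F7 : ∃ X : PilotData ↥F7, X.lstar = 2 ∧ X.S = {v7} := by
  refine ⟨⟨((r7O : 𝓞 ↥F7) : ↥F7)⁻¹, ({v7} : Finset (HeightOneSpectrum (𝓞 ↥F7))), ⟨v7, Finset.mem_singleton_self _⟩,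
    fun v hv => ?_, 5, by norm_num, le_rfl⟩, by norm_num [PilotData.lstar], rfl⟩
  rw [Finset.mem_singleton] at hv
  subst hv
  rw [ord_inv, neg_lt_zero]
  exact (ord_pos_iff_mem (↥F7) v7 r7O r7O_ne_zero).2 (Ideal.mem_span_singleton_self r7O)

/-- **Realising ideles over a pilot datum with `S = {v7}` EXIST**: at the bad place a uniformizer `ϖ` and its powers `ϖ^{j²}`, units
elsewhere — non-zero, units off `S`, integral, of the realising shape at `v7`. [folklore] -/
theorem exists_realising_ideles_F7 (X : PilotData ↥F7) (hS : X.S = {v7}) :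
    ∃ (tq : ∀ (pp : Nat.Primes) (x : (thetaIndex X).Fibre (.inr pp)), haveI : Fact (pp : ℕ).Prime := ⟨pp.2⟩; kOf X pp.1 x)
      (t : ∀ (pp : Nat.Primes) (_ : Fin X.lstar) (x : (thetaIndex X).Fibre (.inr pp)),
        haveI : Fact (pp : ℕ).Prime := ⟨pp.2⟩; kOf X pp.1 x),
      (∀ pp x, tq pp x ≠ 0) ∧
      (∀ (pp : Nat.Primes) (x : (thetaIndex X).Fibre (.inr pp)),
        haveI : Fact (pp : ℕ).Prime := ⟨pp.2⟩; placeOf X pp.1 x ∉ X.S → ‖tq pp x‖ = 1) ∧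
      (∀ (pp : Nat.Primes) (i : Fin X.lstar) (x : (thetaIndex X).Fibre (.inr pp)),
        haveI : Fact (pp : ℕ).Prime := ⟨pp.2⟩; placeOf X pp.1 x ∉ X.S → ‖t pp i x‖ = 1) ∧
      (∀ pp x, ‖tq pp x‖ ≤ 1) ∧
      (∀ w : (thetaIndex X).Fibre (.inr p7), haveI : Fact (p7 : ℕ).Prime := ⟨p7.2⟩
        ∃ ϖ : (kOf X p7.1 w)ˣ, IsUniformizer ϖ ∧ ‖tq p7 w‖ = ‖(ϖ : kOf X p7.1 w)‖ ∧
          ∀ i : Fin X.lstar, ‖t p7 i w‖ = ‖(ϖ : kOf X p7.1 w)‖ ^ (((i : ℕ) + 1) ^ 2)) := by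
  classical
  -- a uniformizer at every fibre point
  have hu : ∀ (pp : Nat.Primes) (x : (thetaIndex X).Fibre (.inr pp)), haveI : Fact (pp : ℕ).Prime := ⟨pp.2⟩
      ∃ ϖ : (kOf X pp.1 x)ˣ, IsUniformizer ϖ := fun pp x => by
    haveI : Fact (pp : ℕ).Prime := ⟨pp.2⟩
    obtain ⟨ϖ, hϖ, -⟩ := exists_isUniformizer_rescaledCompletion (↥F7) pp.1 (placeOf X pp.1 x) (natCast_mem_placeOf X pp.1 x)
    exact ⟨ϖ, hϖ⟩
  choose ϖ hϖ using hu
  refine ⟨fun pp x => haveI : Fact (pp : ℕ).Prime := ⟨pp.2⟩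
      if placeOf X pp.1 x ∈ X.S then (ϖ pp x : kOf X pp.1 x) else 1,
    fun pp i x => haveI : Fact (pp : ℕ).Prime := ⟨pp.2⟩
      if placeOf X pp.1 x ∈ X.S then (ϖ pp x : kOf X pp.1 x) ^ (((i : ℕ) + 1) ^ 2) else 1,
    fun pp x => ?_, fun pp x hx => ?_, fun pp i x hx => ?_, fun pp x => ?_, fun w => ?_⟩
  · haveI : Fact (pp : ℕ).Prime := ⟨pp.2⟩
    dsimp only
    split_ifs
    · exact (ϖ pp x).ne_zero
    · exact one_ne_zero
  · haveI : Fact (pp : ℕ).Prime := ⟨pp.2⟩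
    dsimp only
    rw [if_neg hx, norm_one]
  · haveI : Fact (pp : ℕ).Prime := ⟨pp.2⟩
    dsimp only
    rw [if_neg hx, norm_one]
  · haveI : Fact (pp : ℕ).Prime := ⟨pp.2⟩
    dsimp only
    split_ifs
    · exact (hϖ pp x).norm_lt_one.le
    · rw [norm_one]
  · haveI : Fact (p7 : ℕ).Prime := ⟨p7.2⟩
    have hw : placeOf X p7.1 w ∈ X.S := by rw [placeOf_p7_eq_v7 X w, hS]; exact Finset.mem_singleton_self _
    refine ⟨ϖ p7 w, hϖ p7 w, ?_, fun i => ?_⟩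
    · dsimp only
      rw [if_pos hw]
    · dsimp only
      rw [if_pos hw, norm_pow]

/-- **NON-VACUITY CERTIFICATE (closed statement): over `ℚ(√7)` there are a pilot datum (`S = {v7}`, `l = 5`) and integral pilot ideles
(units off `S`, realising at `v7`) such that for EVERY context datum of abc-iut-c312-7's print-normalised sharp real setting (analytic
logarithms) the (xi-f) licence HOLDS** — an inhabitant of the positive side of the per-datum tame dichotomy outside the one-factor
window. [cite: DupuyHilado2025, §3.4, §3.9, §4.9] [claim: Mochizuki2012, status: disputed] -/
theorem exists_licence_settingPrVolSharp_F7 :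
    ∃ (X : PilotData ↥F7)
      (tq : ∀ (pp : Nat.Primes) (x : (thetaIndex X).Fibre (.inr pp)), haveI : Fact (pp : ℕ).Prime := ⟨pp.2⟩; kOf X pp.1 x)
      (t : ∀ (pp : Nat.Primes) (_ : Fin X.lstar) (x : (thetaIndex X).Fibre (.inr pp)),
        haveI : Fact (pp : ℕ).Prime := ⟨pp.2⟩; kOf X pp.1 x)
      (htq0 : ∀ pp x, tq pp x ≠ 0)
      (htq1 : ∀ (pp : Nat.Primes) (x : (thetaIndex X).Fibre (.inr pp)),
        haveI : Fact (pp : ℕ).Prime := ⟨pp.2⟩; placeOf X pp.1 x ∉ X.S → ‖tq pp x‖ = 1),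
      X.S = {v7} ∧ X.lstar = 2 ∧
      ∀ (M : Type) [Field M] [NumberField M]
        (archPk : ∀ (j : (thetaIndex X).Label) (vQ : (thetaIndex X).VQ),
          Set ((logShellsDH X (analyticLogv ↥F7)).Packet j vQ))
        (archSub : ∀ (j : (thetaIndex X).Label) (v : (thetaIndex X).V),
          Set ((logShellsDH X (analyticLogv ↥F7)).Packet j ((thetaIndex X).over v)))
        (Ψ : ℤ → ∀ v : (thetaIndex X).V, v ∈ (thetaIndex X).Vbad → Set ((logShellsDH X (analyticLogv ↥F7)).StarPacket v))
        (act : ℤ → ∀ v : (thetaIndex X).V, v ∈ (thetaIndex X).Vbad →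
          (logShellsDH X (analyticLogv ↥F7)).StarPacket v → Module.End ℚ ((logShellsDH X (analyticLogv ↥F7)).StarPacket v))
        (Mmod : ℤ → ∀ j : (thetaIndex X).LabelStar, Set ((logShellsDH X (analyticLogv ↥F7)).GlobalPacket j.1))
        (region : ℤ → ∀ j : (thetaIndex X).LabelStar, FinDivisor M → ∀ vQ : (thetaIndex X).VQ,
          Set ((logShellsDH X (analyticLogv ↥F7)).Packet j.1 vQ))
        (n : ℤ) (HT : Type) (LogLink : HT → HT → Type) (IsFull : ∀ {s t : HT}, LogLink s t → Prop)
        (lat : LGPGaussianLogThetaLattice LogLink IsFull)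
        (Frd : Type) (IsoF : Frd → Frd → Type) (Ob : Frd → Type) (realify : Frd → Frd) (Strip : Type)
        (IsoS : Strip → Strip → Type) (Mv : ∀ v : (thetaIndex X).V, v ∈ (thetaIndex X).Vbad → Type)
        [∀ v h, Monoid (Mv v h)]
        (sig : GlobalLGPFrobenioidSignature (thetaIndex X).lstar (thetaIndex X).V (· ∈ (thetaIndex X).Vbad)
          Frd IsoF Ob realify Strip IsoS Mv)
        (split : SplittingMonoids Mv) (ObΔ : Type) (N : ∀ v : (thetaIndex X).V, v ∈ (thetaIndex X).Vbad → Type)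
        [∀ v h, Monoid (N v h)] (qData : QPilotData ObΔ N),
        Thm311ToCor312.Licence (settingPrVolSharp X (logvAnalytic_analyticLogv (F := ↥F7)) M archPk archSub Ψ act Mmod region
          n lat sig split qData tq t htq0 htq1) := by
  obtain ⟨X, hl, hS⟩ := exists_pilotData_F7
  obtain ⟨tq, t, htq0, htq1, ht1, -, h7⟩ := exists_realising_ideles_F7 X hS
  refine ⟨X, tq, t, htq0, htq1, hS, hl, ?_⟩
  intro M _ _ archPk archSub Ψ act Mmod region n HT LogLink IsFull lat Frd IsoF Ob realify Strip IsoS Mv _ sig split ObΔ N _ qData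
  exact licence_settingPrVolSharp_F7 X (logvAnalytic_analyticLogv (F := ↥F7)) M archPk archSub Ψ act Mmod region n lat sig split
    qData tq t htq0 htq1 hl (fun v hv => by rw [hS, Finset.mem_singleton] at hv; exact hv) ht1 h7

end Summit.ABC.IUTFork.Thm311.Real

end
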